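/-
Copyright (c) 2026 the pub-hodgecm-mathlib formalisation cell (harness21).  Prover seat hodgecm-mathlib-F0P3a-p07 (g13), 2026-09-01.  Road «S3-ram» seeding wave (LEAD T11-41∕T11-60; owner F0P3a-p06 (g15)):
the (e3) LEVI CLAUSE of fold v6 `stub_levelOneRowsRam` :118 on the PINNED family `ψ^ram = ![χ₀, χ♯]` — junction of ★ p846996 §3 (F0P3a-p01 (g16)) with the χ♯ Levi row ★ p847135 (this seat).
-/
import Literature.NumberTheory.Rogawski1990.DepthZeroKappaTransferLeviRamifiedFamily        -- ★ p846996 (F0P3a-p01 (g16)): §3 `…_eq_sum_of_levi_ramified_levelOne_of_frame_of_integral_eq` (sockets `hN`, `hψ`)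
import Literature.NumberTheory.Rogawski1990.DepthZeroTransferHValuesLeviRamifiedModular      -- ★ p847061∕p847135 (this seat): `stableOrbitalIntegralRel_chiSharp_eq_mul_chiZero_of_levi_ramified` (the `s = 1` row)
import Literature.NumberTheory.Rogawski1990.UnitFundamentalLemmaInertFlickerFrame            -- ★ `isUnit_two_integer_iff_valued_eq_one`
import HarnessLib

/-!
# The (e3) LEVI clause of the tame-ramified `v`-level-1 socket on the PINNED family `ψ^ram = ![χ₀, χ♯]`: socket `hψ` DISCHARGED

Topic `NumberTheory/Rogawski1990`; namespace `Literature.NumberTheory.Rogawski1990`.  ONE THEOREM (no definition, no instance, no notation, no named fact, no `sorry`).  Cell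
`pub/hodgecm-mathlib`, crux H413 = `stmt-HodgeConjecture-24833`; road «S3-ram» (LEAD F0P3a-plan (g12) T11-41; owner F0P3a-p06 (g15)); END fold v6 `stub_levelOneRowsRam` :118 (F0P3a-p03 (g16)).
Seat F0P3a-p07 (g13).  HONEST LABEL: HC_CM is proved only modulo the cell's 2 remaining named inputs (hLiu418 24832, h413 24833) until rung 0 closes; «S3-ram» is Literature seeding with no
books consequence; this file is unconditional and discharges nothing by itself.

THE MATHEMATICS ([Rogawski1990] §4.9 Prop. 4.9.1 pp. 54–56; [Tits1979] §3.9).  ★ `finsum_delta_mul_classOrbitalIntegral_eq_sum_of_levi_ramified_levelOne_of_frame_of_integral_eq` (p846996 §3)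
proves the Levi population clause of :118 for an ARBITRARY finite family `ψH` whose Levi values are `yv s`-proportional to the `χ₀`-row (socket `hψ`).  For the family of record
`ψ^ram = ![χ₀, χ♯]` (`χ₀ = 1_{K_H}·[(red h_{2,w} − 1)² = 0 ∧ rank = 0]`, `χ♯ = 1_{K♯ × U(Φ₁)_v}` ENTRYWISE) the proportionality constants are `yv = ![1, (q+1)∕2]`: `s = 0` trivially and
`s = 1` by ★ `stableOrbitalIntegralRel_chiSharp_eq_mul_chiZero_of_levi_ramified` (p847135: `Φ^st(γ_H, χ♯) = ((q+1)∕2)·Φ^st(γ_H, χ₀)` at every regular 1-deep Levi `γ_H`).  Hence the socket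
`hψ` is DISCHARGED and the coefficient test reads **`(a 0 + a 1·(q+1)∕2)·ν_H(K_H) = (y_λ, θ)_v·ν_G(K′)·X`** — the Levi relation on the JOIN's `a` (SPEC P1ram-T0 (T4), CERT fa4d2046 ∕ R-243); the
only remaining socket is `hN` (the `N ∩ K₃`-integral of the piece; F0P3-p02 (g16) L4∕L5 ★ chain).  Binders = ★ p846996 §3 VERBATIM with `{r} (ψH) (yv a) (hψ)` ↦ `(ϖ) (hϖ) (a : Fin 2 → ℂ)`,
conclusion = :118's RHS at `r := 2`, `ψ := ![χ₀, χ♯]` token for token.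
* `finsum_delta_mul_classOrbitalIntegral_eq_sum_pinned_of_levi_ramified_levelOne_of_frame_of_integral_eq`.

## References
* [Rogawski1990] J. D. Rogawski, *Automorphic Representations of Unitary Groups in Three Variables*, Ann. of Math. Stud. 123 (1990), §4.9 Prop. 4.9.1, (4.9.2) pp. 54–56; §4.3 p. 43.
* [Tits1979] J. Tits, *Reductive groups over local fields*, PSPM 33.1 (1979), §3.9.
* [LanglandsShelstad1987] R. P. Langlands, D. Shelstad, *On the definition of transfer factors*, Math. Ann. 278 (1987), §1.3–1.4.
-/

set_option autoImplicit false

noncomputable section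

open NumberField IsDedekindDomain MeasureTheory Measure Topology Filter Matrix
open Literature.NumberTheory.Automorphic Literature.NumberTheory.Automorphic.UnitaryGroup Literature.NumberTheory.Automorphic.IntegralReduction
open Literature.NumberTheory.GaloisRepresentations Literature.NumberTheory.GaloisRepresentations.IsNonarchimedeanLocalField Literature.NumberTheory.QuadraticForms
open scoped Matrix MatrixGroups NNReal ENNReal ValuativeRel

namespace Literature.NumberTheory.Rogawski1990

set_option maxHeartbeats 1600000 in
-- instance-term unification on the CM local carriers (as in ★ p846996)
open scoped Classical in
/-- **(e3) THE LEVI CLAUSE OF THE `v`-LEVEL-1 SOCKET ON THE PINNED FAMILY `ψ^ram = ![χ₀, χ♯]`** at a tame-ramified non-split place, for a Borel `Ad K′`-invariant piece left-invariant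
under `K(ϖ_v)` (fold v6 :118 token `hg1`): modulo the single socket `hN` (the `N ∩ K₃`-average `X` of the piece), the κ-weighted sum of its orbital integrals at every `G`-regular LEVI `γ_H`
near `1` is `a 0·Φ^st(γ_H, χ₀) + a 1·Φ^st(γ_H, χ♯)` as soon as `(a 0 + a 1·(q+1)∕2)·ν_H(K_H) = (y_λ, θ)_v·ν_G(K′)·X` — ★ p846996 §3 with its socket `hψ` discharged by `yv = ![1, (q+1)∕2]`
(★ `stableOrbitalIntegralRel_chiSharp_eq_mul_chiZero_of_levi_ramified`). [cite: Rogawski1990, §4.9 Prop. 4.9.1 (a)(b) pp. 54–56; §4.3 (4.3.1) p. 43] [cite: Tits1979, §3.9] -/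
theorem finsum_delta_mul_classOrbitalIntegral_eq_sum_pinned_of_levi_ramified_levelOne_of_frame_of_integral_eq
    (L : Type) [Field L] [NumberField L] [IsCMField L] (H' : Matrix (Fin 3) (Fin 3) L) (μ : HeckeCharacter L)
    {v : HeightOneSpectrum (𝓞 ↥(maximalRealSubfield L))}
    (hH' : (H'.map (cmConjRingHom L)).transpose = H') (w : PlacesOver L v)
    (hw : IsCMField.complexConj L • w.1 = w.1) (he : v.asIdeal.ramificationIdx' w.1.asIdeal ≠ 1)
    -- good reduction (`_hH'i` idle: the frame binder `hframe`∕`hA` below carries the integrality; kept so the binder list is END's socket frame)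
    (hH'w : IsUnit (placeForm H' w.1)) (_hH'i : hH'w.unit ∈ glInt 3 (w.1.adicCompletion L))
    (h2 : IsUnit (2 : 𝒪[w.1.adicCompletion L]))
    -- the integral antidiagonal FRAME of `H′_w` (END fold v2 socket binders; supplied at a tame-ramified `w` by ★ p846344 `exists_glInt_placeForm_eq_smul_formCongr_antidiagonal_of_neg`)
    (A : GL (Fin 3) (w.1.adicCompletion L)) (hA : A ∈ glInt 3 (w.1.adicCompletion L))
    (hframe : placeForm H' w.1 = (-(placeForm H' w.1).det) • formCongr (galAdicCompletionMap (L := L) (IsCMField.complexConj L) hw) A ((StdForm.antidiagonal 3).over (w.1.adicCompletion L)))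
    [MeasurableSpace ((cmDatum L 3 H').Local v)] [BorelSpace ((cmDatum L 3 H').Local v)]
    [∀ γ : ((cmDatum L 3 H').Local v), MeasurableSpace (((cmDatum L 3 H').Local v) ⧸ Subgroup.centralizer ({γ} : Set ((cmDatum L 3 H').Local v)))]
    [∀ γ : ((cmDatum L 3 H').Local v), BorelSpace (((cmDatum L 3 H').Local v) ⧸ Subgroup.centralizer ({γ} : Set ((cmDatum L 3 H').Local v)))]
    [MeasurableSpace ((cmDatum L 2 (Matrix.of fun i j : Fin 2 => if i.val + j.val + 1 = 2 then (1 : L) else 0)).Local v ×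
      (cmDatum L 1 (Matrix.of fun i j : Fin 1 => if i.val + j.val + 1 = 1 then (1 : L) else 0)).Local v)]
    [BorelSpace ((cmDatum L 2 (Matrix.of fun i j : Fin 2 => if i.val + j.val + 1 = 2 then (1 : L) else 0)).Local v ×
      (cmDatum L 1 (Matrix.of fun i j : Fin 1 => if i.val + j.val + 1 = 1 then (1 : L) else 0)).Local v)]
    [∀ a : ((cmDatum L 2 (Matrix.of fun i j : Fin 2 => if i.val + j.val + 1 = 2 then (1 : L) else 0)).Local v ×
      (cmDatum L 1 (Matrix.of fun i j : Fin 1 => if i.val + j.val + 1 = 1 then (1 : L) else 0)).Local v),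
      MeasurableSpace (((cmDatum L 2 (Matrix.of fun i j : Fin 2 => if i.val + j.val + 1 = 2 then (1 : L) else 0)).Local v ×
      (cmDatum L 1 (Matrix.of fun i j : Fin 1 => if i.val + j.val + 1 = 1 then (1 : L) else 0)).Local v) ⧸ Subgroup.centralizer ({a} : Set ((cmDatum L 2 (Matrix.of fun i j : Fin 2 => if i.val + j.val + 1 = 2 then (1 : L) else 0)).Local v ×
      (cmDatum L 1 (Matrix.of fun i j : Fin 1 => if i.val + j.val + 1 = 1 then (1 : L) else 0)).Local v)))]
    [∀ a : ((cmDatum L 2 (Matrix.of fun i j : Fin 2 => if i.val + j.val + 1 = 2 then (1 : L) else 0)).Local v ×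
      (cmDatum L 1 (Matrix.of fun i j : Fin 1 => if i.val + j.val + 1 = 1 then (1 : L) else 0)).Local v),
      BorelSpace (((cmDatum L 2 (Matrix.of fun i j : Fin 2 => if i.val + j.val + 1 = 2 then (1 : L) else 0)).Local v ×
      (cmDatum L 1 (Matrix.of fun i j : Fin 1 => if i.val + j.val + 1 = 1 then (1 : L) else 0)).Local v) ⧸ Subgroup.centralizer ({a} : Set ((cmDatum L 2 (Matrix.of fun i j : Fin 2 => if i.val + j.val + 1 = 2 then (1 : L) else 0)).Local v ×
      (cmDatum L 1 (Matrix.of fun i j : Fin 1 => if i.val + j.val + 1 = 1 then (1 : L) else 0)).Local v)))]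
    (νH : Measure ((cmDatum L 2 (Matrix.of fun i j : Fin 2 => if i.val + j.val + 1 = 2 then (1 : L) else 0)).Local v ×
      (cmDatum L 1 (Matrix.of fun i j : Fin 1 => if i.val + j.val + 1 = 1 then (1 : L) else 0)).Local v)) [νH.IsHaarMeasure] [νH.IsMulRightInvariant]
    (νG : Measure ((cmDatum L 3 H').Local v)) [νG.IsHaarMeasure] [νG.IsMulRightInvariant]
    {mH : OrbitalMeasureFamily ((cmDatum L 2 (Matrix.of fun i j : Fin 2 => if i.val + j.val + 1 = 2 then (1 : L) else 0)).Local v ×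
      (cmDatum L 1 (Matrix.of fun i j : Fin 1 => if i.val + j.val + 1 = 1 then (1 : L) else 0)).Local v)} {mG : OrbitalMeasureFamily ((cmDatum L 3 H').Local v)}
    (hmH : mH.IsCanonical (IsLocalGRegular L v) νH)
    (hmG : mG.IsCanonical (fun γ => IsRegularElt (γ.val : GL (Fin 3) (UnitaryGroup.LocalRing L v))) νG)
    -- the piece: Borel, `Ad K′`-invariant, LEFT-INVARIANT under the `v`-level-1 congruence set `K(ϖ_v)` (END fold v6 `stub_levelOneRowsRam` :118 token `hg1` VERBATIM)
    (g : ((cmDatum L 3 H').Local v) → ℂ) (hgm : Measurable g)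
    (hginv : ∀ u ∈ cmLocalIntegralLevel L 3 H' v, ∀ x, g (u * x * u⁻¹) = g x)
    (hg1 : ∀ u : (cmDatum L 3 H').Local v,
      (∀ a b, Valued.v (((toPlace v w (HeckeCharacter.uniformizer ↥(maximalRealSubfield L) v : v.adicCompletion ↥(maximalRealSubfield L))) ^ 1)⁻¹ *
        ((((localNonsplitEquiv (IsCMField.complexConj L) H' (IsCMField.complexConj_ne_one L) w hw u :
            ↥(unitaryGroupOfForm (galAdicCompletionMap (L := L) (IsCMField.complexConj L) hw) (placeForm H' w.1))) : GL (Fin 3) (w.1.adicCompletion L)) :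
              Matrix (Fin 3) (Fin 3) (w.1.adicCompletion L)) a b - (1 : Matrix (Fin 3) (Fin 3) (w.1.adicCompletion L)) a b)) ≤ 1) →
      ∀ x, g (u * x) = g x)
    (X : ℂ)
    -- SOCKET (the `𝔭`-layer strata enter ONLY here): the `N ∩ K₃`-integral of `g` through every level frame with integral matrix reading, any Haar `μ_N`
    (hN : ∀ [MeasurableSpace ↥(unitaryGroupOfForm (conjLocal L (IsCMField.complexConj L) v) (cmLocalForm L 3 v))] [BorelSpace ↥(unitaryGroupOfForm (conjLocal L (IsCMField.complexConj L) v) (cmLocalForm L 3 v))]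
      (ψ : (cmDatum L 3 H').Local v ≃ₜ* ↥(unitaryGroupOfForm (conjLocal L (IsCMField.complexConj L) v) (cmLocalForm L 3 v)))
      (_hψK : ∀ g : (cmDatum L 3 H').Local v, ψ g ∈ cmLocalIntegralLevel L 3 (Matrix.of fun i j : Fin 3 => if i.val + j.val + 1 = 3 then (1 : L) else 0) v ↔ g ∈ cmLocalIntegralLevel L 3 H' v)
      (_hψc : ∀ g : (cmDatum L 3 H').Local v, IsConj (g.val : GL (Fin 3) (LocalRing L v)) ((ψ g : ↥(unitaryGroupOfForm (conjLocal L (IsCMField.complexConj L) v) (cmLocalForm L 3 v))) : GL (Fin 3) (LocalRing L v)))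
      (T : GL (Fin 3) (w.1.adicCompletion L)) (_hT : T ∈ glInt 3 (w.1.adicCompletion L))
      (_hψT : ∀ g : (cmDatum L 3 H').Local v, localGLPiEquiv L 3 v (((ψ g : ↥(unitaryGroupOfForm (conjLocal L (IsCMField.complexConj L) v) (cmLocalForm L 3 v)))) : GL (Fin 3) (LocalRing L v)) w =
        T * localGLPiEquiv L 3 v (g.val : GL (Fin 3) (LocalRing L v)) w * T⁻¹)
      (μN : Measure ↥(unipotentU (conjLocal L (IsCMField.complexConj L) v) (cmLocalForm L 3 v))) [μN.IsHaarMeasure],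
      ∫ n, g (ψ.symm (n : ↥(unitaryGroupOfForm (conjLocal L (IsCMField.complexConj L) v) (cmLocalForm L 3 v)))) ∂μN =
        (μN.real {n : ↥(unipotentU (conjLocal L (IsCMField.complexConj L) v) (cmLocalForm L 3 v)) |
            (n : ↥(unitaryGroupOfForm (conjLocal L (IsCMField.complexConj L) v) (cmLocalForm L 3 v))) ∈
              cmLocalIntegralLevel L 3 (Matrix.of fun i j : Fin 3 => if i.val + j.val + 1 = 3 then (1 : L) else 0) v} : ℂ) * X)
    -- the C-Δ LEVI VALUE is DISCHARGED (★ p846910, p07 (g12)): guard `μ|_{𝕀_{L⁺}} = ω` and `y_λ ∈ L⁺_v` with `ι_w y_λ = −det H′_w` (the core's epsilon is `(y_λ, θ)_v`)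
    (hμω : ∀ x : ideleGroup ↥(maximalRealSubfield L), μ (AdeleRing.ideleBaseChange ↥(maximalRealSubfield L) L x) = quadraticHeckeCharCM L x)
    (yl : v.adicCompletion ↥(maximalRealSubfield L)) (hyl : toPlace v w yl = -(placeForm H' w.1).det)
    -- the PINNED test family `ψ^ram = ![χ₀, χ♯]` (A-p16 (g31) skeleton v4 ∕ ★ p847020 texts): the uniformiser `ϖ` of `L_w` naming `K♯` (fold v6 :118 binder) and the coefficients
    (ϖ : (w.1.adicCompletion L)) (hϖ : Valued.v ϖ = WithZero.exp (-1 : ℤ)) (a : Fin 2 → ℂ)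
    -- the coefficient test on `ψ^ram`: `(a₀ + a₁·(q+1)∕2)·ν_H(K_H) = ε·ν_G(K′)·X` (the Levi H-row is `(1, (q+1)∕2)`·Φ^st(χ₀), ★ p846841 ∕ ★ p847135); `X` = socket `hN`
    (ha : (a 0 + a 1 * (((Ideal.absNorm v.asIdeal : ℂ) + 1) / 2)) * (νH.real (((cmLocalIntegralLevel L 2 (Matrix.of fun i j : Fin 2 => if i.val + j.val + 1 = 2 then (1 : L) else 0) v).prod
                (cmLocalIntegralLevel L 1 (Matrix.of fun i j : Fin 1 => if i.val + j.val + 1 = 1 then (1 : L) else 0) v) : Subgroup _) : Set _) : ℂ) =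
            (hilbertSymbol (v.adicCompletion ↥(maximalRealSubfield L)) yl
        (algebraMap ↥(maximalRealSubfield L) _ ((cmQuadraticGenerator L : 𝓞 ↥(maximalRealSubfield L)) : ↥(maximalRealSubfield L))) : ℂ) *
        (νG.real (cmLocalIntegralLevel L 3 H' v : Set ((cmDatum L 3 H').Local v)) : ℂ) * X) :
        ∃ V ∈ 𝓝 (1 : ((cmDatum L 2 (Matrix.of fun i j : Fin 2 => if i.val + j.val + 1 = 2 then (1 : L) else 0)).Local v ×
        (cmDatum L 1 (Matrix.of fun i j : Fin 1 => if i.val + j.val + 1 = 1 then (1 : L) else 0)).Local v)),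
      ∀ γH ∈ V, IsLocalGRegular L v γH →
        (∃ (y : ((cmDatum L 2 (Matrix.of fun i j : Fin 2 => if i.val + j.val + 1 = 2 then (1 : L) else 0)).Local v ×
        (cmDatum L 1 (Matrix.of fun i j : Fin 1 => if i.val + j.val + 1 = 1 then (1 : L) else 0)).Local v)) (d' : Fin 2 → (UnitaryGroup.LocalRing L v)ˣ),
          glDiagonal 2 (UnitaryGroup.LocalRing L v) d' = ((y * γH * y⁻¹).1.val : GL (Fin 2) (UnitaryGroup.LocalRing L v))) →
        ∑ᶠ cG : ConjClasses ((cmDatum L 3 H').Local v),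
            ((finExplicitCollection L H' μ (finExplicitDelta_conj_left_all L H' μ) (finExplicitDelta_conj_right_all L H' μ)) v).Δ γH (Quotient.out cG) *
              classOrbitalIntegral mG g cG =
          ∑ s, a s * stableOrbitalIntegralRel (IsLocalStablyConjH L v) mH
            ((![((((cmLocalIntegralLevel L 2 (Matrix.of fun i j : Fin 2 => if i.val + j.val + 1 = 2 then (1 : L) else 0) v).prod (cmLocalIntegralLevel L 1 (Matrix.of fun i j : Fin 1 => if i.val + j.val + 1 = 1 then (1 : L) else 0) v) : Subgroup ((cmDatum L 2 (Matrix.of fun i j : Fin 2 => if i.val + j.val + 1 = 2 then (1 : L) else 0)).Local v × (cmDatum L 1 (Matrix.of fun i j : Fin 1 => if i.val + j.val + 1 = 1 then (1 : L) else 0)).Local v)) : Set ((cmDatum L 2 (Matrix.of fun i j : Fin 2 => if i.val + j.val + 1 = 2 then (1 : L) else 0)).Local v × (cmDatum L 1 (Matrix.of fun i j : Fin 1 => if i.val + j.val + 1 = 1 then (1 : L) else 0)).Local v)).indicator fun h => if (redMat (((h).1.val : GL (Fin 2) (UnitaryGroup.LocalRing L v)).val.map (Pi.evalRingHom (fun w'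 : PlacesOver L v => w'.1.adicCompletion L) w)) - 1) ^ 2 = 0 ∧ (redMat (((h).1.val : GL (Fin 2) (UnitaryGroup.LocalRing L v)).val.map (Pi.evalRingHom (fun w' : PlacesOver L v => w'.1.adicCompletion L) w)) - 1).rank = 0 then (1 : ℂ) else 0),
            (Set.indicator {h : ((cmDatum L 2 (Matrix.of fun i j : Fin 2 => if i.val + j.val + 1 = 2 then (1 : L) else 0)).Local v × (cmDatum L 1 (Matrix.of fun i j : Fin 1 => if i.val + j.val + 1 = 1 then (1 : L) else 0)).Local v) | ∀ a b : Fin 2, Valued.v (ϖ ^ (b : ℕ) * (ϖ ^ (a : ℕ))⁻¹ * (((localNonsplitEquiv (IsCMField.complexConj L) (Matrix.of fun i j : Fin 2 => if i.val + j.val + 1 = 2 then (1 : L) else 0) (IsCMField.complexConj_ne_one L) w hw h.1 : ↥(unitaryGroupOfForm (galAdicCompletionMap (L := L) (IsCMField.complexConj L) hw) (placeForm (Matrix.of fun i j : Fin 2 => if i.val + j.val + 1 = 2 then (1 : L) else 0) w.1))) : GL (Fin 2) (w.1.adicCompletion L)) : Matrix (Fin 2) (Fin 2) (w.1.adicCompletion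 L)) a b) ≤ 1} (fun _ => (1 : ℂ)))] : Fin 2 → ((cmDatum L 2 (Matrix.of fun i j : Fin 2 => if i.val + j.val + 1 = 2 then (1 : L) else 0)).Local v × (cmDatum L 1 (Matrix.of fun i j : Fin 1 => if i.val + j.val + 1 = 1 then (1 : L) else 0)).Local v) → ℂ) s) γH := by
  have h2w : Valued.v (2 : (w.1.adicCompletion L)) = 1 := (isUnit_two_integer_iff_valued_eq_one L w.1).1 h2
  refine finsum_delta_mul_classOrbitalIntegral_eq_sum_of_levi_ramified_levelOne_of_frame_of_integral_eq L H' μ hH' w hw he hH'w _hH'i h2 A hA hframe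
    νH νG hmH hmG g hgm hginv hg1 X hN hμω yl hyl
    (![((((cmLocalIntegralLevel L 2 (Matrix.of fun i j : Fin 2 => if i.val + j.val + 1 = 2 then (1 : L) else 0) v).prod (cmLocalIntegralLevel L 1 (Matrix.of fun i j : Fin 1 => if i.val + j.val + 1 = 1 then (1 : L) else 0) v) : Subgroup ((cmDatum L 2 (Matrix.of fun i j : Fin 2 => if i.val + j.val + 1 = 2 then (1 : L) else 0)).Local v × (cmDatum L 1 (Matrix.of fun i j : Fin 1 => if i.val + j.val + 1 = 1 then (1 : L) else 0)).Local v)) : Set ((cmDatum L 2 (Matrix.of fun i j : Fin 2 => if i.val + j.val + 1 = 2 then (1 : L) else 0)).Local v × (cmDatum L 1 (Matrix.of fun i j : Fin 1 => if i.val + j.val + 1 = 1 then (1 : L) else 0)).Local v)).indicator fun h => if (redMat (((h).1.val : GL (Fin 2) (UnitaryGroup.LocalRing L v)).val.map (Pi.evalRingHom (fun w' : PlacesOver L v => w'.1.adicCompletion L) w)) - 1) ^ 2 = 0 ∧ (redMat (((h).1.val : GL (Fin 2) (UnitaryGroup.LocalRing L v)).val.map (Pi.evalRingHom (fun w' : PlacesOver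 L v => w'.1.adicCompletion L) w)) - 1).rank = 0 then (1 : ℂ) else 0),
            (Set.indicator {h : ((cmDatum L 2 (Matrix.of fun i j : Fin 2 => if i.val + j.val + 1 = 2 then (1 : L) else 0)).Local v × (cmDatum L 1 (Matrix.of fun i j : Fin 1 => if i.val + j.val + 1 = 1 then (1 : L) else 0)).Local v) | ∀ a b : Fin 2, Valued.v (ϖ ^ (b : ℕ) * (ϖ ^ (a : ℕ))⁻¹ * (((localNonsplitEquiv (IsCMField.complexConj L) (Matrix.of fun i j : Fin 2 => if i.val + j.val + 1 = 2 then (1 : L) else 0) (IsCMField.complexConj_ne_one L) w hw h.1 : ↥(unitaryGroupOfForm (galAdicCompletionMap (L := L) (IsCMField.complexConj L) hw) (placeForm (Matrix.of fun i j : Fin 2 => if i.val + j.val + 1 = 2 then (1 : L) else 0) w.1))) : GL (Fin 2) (w.1.adicCompletion L)) : Matrix (Fin 2) (Fin 2) (w.1.adicCompletion L)) a b) ≤ 1} (fun _ => (1 : ℂ)))] : Fin 2 → ((cmDatum L 2 (Matrix.of fun i j : Fin 2 => if i.val + j.val + 1 = 2 then (1 : L) else 0)).Local v × (cmDatum L 1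 (Matrix.of fun i j : Fin 1 => if i.val + j.val + 1 = 1 then (1 : L) else 0)).Local v) → ℂ)
    ![1, (((Ideal.absNorm v.asIdeal : ℂ) + 1) / 2)] a ?_ ?_
  · -- the proportionality rows: `s = 0` trivially, `s = 1` = ★ `stableOrbitalIntegralRel_chiSharp_eq_mul_chiZero_of_levi_ramified` (p07 (g13), p847135)
    refine ⟨Set.univ, Filter.univ_mem, fun γH _ hreg y d' hyd' ht1 s => ?_⟩
    fin_cases s
    · simp only [Fin.zero_eta, Fin.isValue, Matrix.cons_val_zero, one_mul]
    · simp only [Fin.mk_one, Fin.isValue, Matrix.cons_val_one, Matrix.cons_val_fin_one]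
      exact stableOrbitalIntegralRel_chiSharp_eq_mul_chiZero_of_levi_ramified L v w hw νH he h2w ϖ hϖ hmH hreg y hyd' ht1 _
  · -- the coefficient test
    simpa only [Fin.sum_univ_two, Fin.isValue, Matrix.cons_val_zero, Matrix.cons_val_one, Matrix.cons_val_fin_one, mul_one] using ha

end Literature.NumberTheory.Rogawski1990

end
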